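import Mathlib
import Literature.NumberTheory.LFunctions.MertensElementary
import Literature.NumberTheory.LFunctions.Zhang2022.SkeletonPartThree
import HarnessLib

/-!
# Toolkit: sums of a multiplicative majorant over smooth numbers are bounded by the finite Euler
# product, and `∏_{q<y}(1 + k/q + c/q²) ≤ e^{4k+2c}(log y)^k`

Topic `Literature/NumberTheory/LFunctions/Zhang2022` (Landau–Siegel audit tree; verdict-neutral; ZHANG-L
discharge lane, WP16 helper toolkit, seat zl-w16-p4). The two elementary summation devices behind every
"`Σ_{n∈𝒩(𝔮), n<T} |w(n)|τ_k(n)/n ≪ 𝓛^c`" step of Y. Zhang, *Discrete mean estimates and the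
Landau–Siegel zero*, arXiv:2211.02515v1 (2022) [Zhang2022LandauSiegel] — an unrefereed manuscript
under adjudication; nothing here bears on its Theorems 1–2 — e.g. §16 (16.15) p. 94 ("`+ O(1/𝓛)`",
typed `Typed.Section16B.Inline16_varpi2WeightSum`: `Σ_{n₁∈𝒩(𝔮),n₁<T}|ϖ₂ⱼ(n₁)|τ₃(n₁)/n₁ ≪ 𝓛⁶`) and
§15 p. 87 (§15.u050). Here `𝒩(𝔮)` (`Skeleton.nset (Skeleton.frakq D)`, `𝔮 = ∏_{q<D⁴} q`) is the set
of `D⁴`-smooth numbers (`mem_nset_frakq_iff`).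

PROVED here (theorems only; no named facts):

* `sum_smooth_multMajorant_div_le_prod` — **Rankin/Euler-product majorant**: for local weights
  `a(q,r) ≥ 0` with `Σ_r a(q,r)q^{−r}` convergent at every prime `q`, and any finite set `A` of
  `y`-smooth numbers, `Σ_{n∈A} (∏_{q^r ∥ n} a(q,r))/n ≤ ∏_{q<y} (1 + Σ_{r≥1} a(q,r)/q^r)` — Mathlib's
  Euler product over smooth numbers (`EulerProduct.summable_and_hasSum_smoothNumbers_prod_primesBelow_tsum`)
  for the multiplicative function `n ↦ (∏_{q^r∥n} a(q,r))/n`, plus positivity;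
* `prod_primesBelow_one_add_le_log_pow` — **the size of such Euler products**: if
  `0 ≤ e(q) ≤ k/q + c/q²` for the primes `q < y` (`y ≥ 3`, `k ∈ ℕ`, `c ≥ 0`) then
  `∏_{q<y}(1 + e(q)) ≤ e^{4k+2c}·(log y)^k`, from `1 + x ≤ eˣ`, the tree's elementary Mertens bound
  `MertensBound.sum_inv_prime_le` (`Σ_{p≤N} 1/p ≤ log log N + 4`) and `Σ_{n≥1} n⁻² = π²/6 ≤ 2`;
* `mem_nset_frakq_iff` — `n ∈ 𝒩(𝔮) ↔ n ∈ Nat.smoothNumbers (D⁴)`.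

## References

* R. R. Hall, G. Tenenbaum, *Divisors*, Cambridge Tracts in Math. 90 (1988), §0.2 (sums of
  multiplicative functions over friable integers via Euler products). [cite: HallTenenbaum1988, §0.2]
* G. H. Hardy, E. M. Wright, *An Introduction to the Theory of Numbers*, 6th ed., Thm 427 (Mertens).
  [cite: HardyWright2008, Thm 427]
* Y. Zhang, arXiv:2211.02515v1 (2022), §16 (16.15) p. 94; §15 p. 87. [cite: Zhang2022LandauSiegel, §16 (16.15) p.94]
-/

noncomputable section

open Real Finset
open Literature.NumberTheory.LFunctions.Zhang2022.Skeleton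

namespace Literature.NumberTheory.LFunctions.Zhang2022.SmoothEulerMajorant

/-! ## The multiplicative majorant `M_a(n) = ∏_{q^r ∥ n} a(q,r)` attached to local weights -/

/-- `M_a` (`M_a(n) := ∏_{q ∈ primeFactors n} a(q, v_q(n))`) is multiplicative on coprime arguments.
[folklore] -/
private theorem majorant_mul_of_coprime (a : ℕ → ℕ → ℝ) {m n : ℕ} (h : Nat.Coprime m n) :
    ∏ q ∈ (m * n).primeFactors, a q ((m * n).factorization q) =
      (∏ q ∈ m.primeFactors, a q (m.factorization q)) * ∏ q ∈ n.primeFactors, a q (n.factorization q) := by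
  rcases eq_or_ne m 0 with rfl | hm
  · have hn : n = 1 := by simpa using h
    subst hn; simp
  rcases eq_or_ne n 0 with rfl | hn
  · have hm1 : m = 1 := by simpa using h
    subst hm1; simp
  rw [Nat.primeFactors_mul hm hn, Finset.prod_union h.disjoint_primeFactors]
  have hfac : (m * n).factorization = m.factorization + n.factorization := Nat.factorization_mul hm hn
  congr 1
  · refine Finset.prod_congr rfl fun q hq => ?_
    have hq' : q ∉ n.primeFactors := Finset.disjoint_left.mp h.disjoint_primeFactors hq
    have h0 : n.factorization q = 0 := by
      rwa [← Finsupp.notMem_support_iff, Nat.support_factorization]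
    rw [hfac, Finsupp.add_apply, h0, add_zero]
  · refine Finset.prod_congr rfl fun q hq => ?_
    have hq' : q ∉ m.primeFactors := Finset.disjoint_right.mp h.disjoint_primeFactors hq
    have h0 : m.factorization q = 0 := by
      rwa [← Finsupp.notMem_support_iff, Nat.support_factorization]
    rw [hfac, Finsupp.add_apply, h0, zero_add]

/-- `M_a(q^r) = a(q,r)` at a prime power, `r ≥ 1`. [folklore] -/
private theorem majorant_prime_pow (a : ℕ → ℕ → ℝ) {q : ℕ} (hq : q.Prime) {r : ℕ} (hr : r ≠ 0) :
    ∏ p ∈ (q ^ r).primeFactors, a p ((q ^ r).factorization p) = a q r := by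
  rw [Nat.primeFactors_prime_pow hr hq, Finset.prod_singleton, Nat.Prime.factorization_pow hq,
    Finsupp.single_eq_same]

/-- `M_a ≥ 0` for nonnegative weights. [folklore] -/
private theorem majorant_nonneg {a : ℕ → ℕ → ℝ} (ha : ∀ q r, 0 ≤ a q r) (n : ℕ) :
    0 ≤ ∏ q ∈ n.primeFactors, a q (n.factorization q) :=
  Finset.prod_nonneg fun q _ => ha q _

/-! ## The Euler-product majorant over smooth numbers -/

/-- **Sums of a multiplicative majorant over smooth numbers** (Rankin's device without the `n^δ`
twist): for local weights `a(q,r) ≥ 0` such that `Σ_{r≥1} a(q,r)/q^r` converges at every prime `q`,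
and any finite set `A` of `y`-smooth positive integers,
`Σ_{n∈A} M_a(n)/n ≤ ∏_{q<y, q prime} (1 + Σ_{r≥1} a(q,r)/q^r)`, `M_a(n) = ∏_{q^r∥n} a(q,r)` written as
`∏_{q ∈ primeFactors n} a(q, v_q(n))` — the finite Euler product of the
multiplicative function `n ↦ M_a(n)/n` over the primes below `y` equals its full sum over ALL `y`-smooth
numbers (Mathlib's `EulerProduct.summable_and_hasSum_smoothNumbers_prod_primesBelow_tsum`), of which the
sum over `A` is a part. [cite: HallTenenbaum1988, §0.2] -/
theorem sum_smooth_multMajorant_div_le_prod {a : ℕ → ℕ → ℝ} (ha : ∀ q r, 0 ≤ a q r)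
    (hsum : ∀ q : ℕ, q.Prime → Summable fun r : ℕ => a q (r + 1) / (q : ℝ) ^ (r + 1))
    {y : ℕ} {A : Finset ℕ} (hA : ∀ n ∈ A, n ∈ Nat.smoothNumbers y) :
    ∑ n ∈ A, (∏ q ∈ n.primeFactors, a q (n.factorization q)) / n ≤
      ∏ q ∈ y.primesBelow, (1 + ∑' r : ℕ, a q (r + 1) / (q : ℝ) ^ (r + 1)) := by
  classical
  -- the multiplicative function `f(n) = M_a(n)/n`
  set f : ℕ → ℝ := fun n => (∏ q ∈ n.primeFactors, a q (n.factorization q)) / n with hf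
  have hf₁ : f 1 = 1 := by simp [hf]
  have hmul : ∀ {m n : ℕ}, Nat.Coprime m n → f (m * n) = f m * f n := by
    intro m n h
    simp only [hf]
    rw [majorant_mul_of_coprime a h, Nat.cast_mul]
    rcases eq_or_ne m 0 with rfl | hm
    · simp
    rcases eq_or_ne n 0 with rfl | hn
    · simp
    field_simp
  have hf0 : ∀ n, 0 ≤ f n := fun n => div_nonneg (majorant_nonneg ha n) (Nat.cast_nonneg n)
  -- the local values `f(q^r) = a(q,r)/q^r` (`r ≥ 1`), `f(q^0) = 1`
  have hfpow : ∀ {q : ℕ}, q.Prime → ∀ r : ℕ, f (q ^ (r + 1)) = a q (r + 1) / (q : ℝ) ^ (r + 1) := by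
    intro q hq r
    simp only [hf]
    rw [majorant_prime_pow a hq (Nat.succ_ne_zero r), Nat.cast_pow]
  have hloc : ∀ {q : ℕ}, q.Prime → Summable fun r : ℕ => ‖f (q ^ r)‖ := by
    intro q hq
    have h1 : Summable fun r : ℕ => ‖f (q ^ (r + 1))‖ := by
      refine (hsum q hq).norm.congr fun r => ?_
      rw [hfpow hq]
    exact (summable_nat_add_iff 1).mp h1
  obtain ⟨hS, hH⟩ :=
    EulerProduct.summable_and_hasSum_smoothNumbers_prod_primesBelow_tsum hf₁ hmul hloc y
  -- the local sums: `Σ_r f(q^r) = 1 + Σ_{r≥1} a(q,r)/q^r`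
  have htsum : ∀ q ∈ y.primesBelow,
      ∑' r : ℕ, f (q ^ r) = 1 + ∑' r : ℕ, a q (r + 1) / (q : ℝ) ^ (r + 1) := by
    intro q hq
    have hqp : q.Prime := (Nat.mem_primesBelow.mp hq).2
    have hs : Summable fun r : ℕ => f (q ^ r) := (hloc hqp).of_norm
    rw [hs.tsum_eq_zero_add, pow_zero, hf₁]
    congr 1
    exact tsum_congr fun r => hfpow hqp r
  rw [← Finset.prod_congr rfl htsum]
  -- the sum over `A` is part of the sum over all `y`-smooth numbers
  have hle : ∑ n ∈ A, f n ≤ ∏ p ∈ y.primesBelow, ∑' n : ℕ, f (p ^ n) := by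
    set A' : Finset (Nat.smoothNumbers y) := A.subtype (· ∈ Nat.smoothNumbers y) with hA'
    have hsumA : ∑ n ∈ A, f n = ∑ m ∈ A', f (m : ℕ) := by
      rw [hA', Finset.sum_subtype_eq_sum_filter]
      rw [Finset.filter_true_of_mem hA]
    rw [hsumA]
    exact sum_le_hasSum A' (fun m _ => hf0 m) hH
  simpa [hf] using hle

/-! ## The size of the Euler product: `∏_{q<y}(1 + k/q + c/q²) ≤ e^{4k+2c}(log y)^k` -/

/-- `Σ_{q<y, q prime} 1/q ≤ log log y + 4` for `y ≥ 2` (the tree's elementary Mertens bound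
`MertensBound.sum_inv_prime_le` over `p ≤ y`, which contains the primes `< y`).
[cite: HardyWright2008, Thm 427] -/
theorem sum_primesBelow_inv_le {y : ℕ} (hy : 2 ≤ y) :
    ∑ q ∈ y.primesBelow, (1 : ℝ) / q ≤ Real.log (Real.log y) + 4 := by
  have hsub : y.primesBelow ⊆ Nat.primesLE y := by
    intro q hq
    rw [Nat.mem_primesBelow] at hq
    exact Nat.mem_primesLE.mpr ⟨hq.1.le, hq.2⟩
  exact (Finset.sum_le_sum_of_subset_of_nonneg hsub fun q _ _ => by positivity).trans
    (MertensBound.sum_inv_prime_le y hy)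

/-- `Σ_{q<y, q prime} 1/q² ≤ 2` (crudely, `Σ_{n≥1} n⁻² = π²/6`). [folklore] -/
private theorem sum_primesBelow_inv_sq_le (y : ℕ) :
    ∑ q ∈ y.primesBelow, (1 : ℝ) / (q : ℝ) ^ 2 ≤ 2 := by
  have hH := hasSum_zeta_two
  have hle : ∑ q ∈ y.primesBelow, (1 : ℝ) / (q : ℝ) ^ 2 ≤ Real.pi ^ 2 / 6 :=
    sum_le_hasSum _ (fun n _ => by positivity) hH
  have hπ : Real.pi ^ 2 / 6 ≤ 2 := by nlinarith [Real.pi_lt_d2, Real.pi_pos]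
  exact hle.trans hπ

/-- **The size of an Euler product with local terms `≤ k/q + c/q²`**: for `y ≥ 3`, `k ∈ ℕ`, `c ≥ 0`
and `0 ≤ e(q) ≤ k/q + c/q²` at every prime `q < y`,
`∏_{q<y, q prime}(1 + e(q)) ≤ e^{4k+2c}·(log y)^k` (`1 + x ≤ eˣ`, Mertens `Σ_{q≤y}1/q ≤ log log y + 4`,
`Σ 1/q² ≤ 2`, `exp(k·log log y) = (log y)^k`). [cite: HardyWright2008, Thm 427] -/
theorem prod_primesBelow_one_add_le_log_pow {y : ℕ} (hy : 3 ≤ y) (k : ℕ) {c : ℝ} (hc : 0 ≤ c)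
    {e : ℕ → ℝ} (he0 : ∀ q ∈ y.primesBelow, 0 ≤ e q)
    (he : ∀ q ∈ y.primesBelow, e q ≤ (k : ℝ) / q + c / (q : ℝ) ^ 2) :
    ∏ q ∈ y.primesBelow, (1 + e q) ≤ Real.exp (4 * k + 2 * c) * Real.log y ^ k := by
  have hy2 : 2 ≤ y := by omega
  have hlogy : 0 < Real.log y := Real.log_pos (by exact_mod_cast (show 1 < y by omega))
  -- `∏(1+e) ≤ exp(Σ e)`
  have h1 : ∏ q ∈ y.primesBelow, (1 + e q) ≤ Real.exp (∑ q ∈ y.primesBelow, e q) := by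
    rw [Real.exp_sum]
    exact Finset.prod_le_prod (fun q hq => by linarith [he0 q hq]) fun q _ => by
      linarith [Real.add_one_le_exp (e q)]
  -- `Σ e ≤ k(log log y + 4) + 2c`
  have h2 : ∑ q ∈ y.primesBelow, e q ≤ (k : ℝ) * (Real.log (Real.log y) + 4) + c * 2 := by
    calc ∑ q ∈ y.primesBelow, e q ≤ ∑ q ∈ y.primesBelow, ((k : ℝ) / q + c / (q : ℝ) ^ 2) :=
          Finset.sum_le_sum he
      _ = (k : ℝ) * ∑ q ∈ y.primesBelow, (1 : ℝ) / q + c * ∑ q ∈ y.primesBelow, 1 / (q : ℝ) ^ 2 := by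
          rw [Finset.sum_add_distrib, Finset.mul_sum, Finset.mul_sum]
          congr 1 <;> refine Finset.sum_congr rfl fun q _ => ?_ <;> ring
      _ ≤ (k : ℝ) * (Real.log (Real.log y) + 4) + c * 2 := by
          gcongr
          · exact sum_primesBelow_inv_le hy2
          · exact sum_primesBelow_inv_sq_le y
  calc ∏ q ∈ y.primesBelow, (1 + e q) ≤ Real.exp (∑ q ∈ y.primesBelow, e q) := h1
    _ ≤ Real.exp ((k : ℝ) * (Real.log (Real.log y) + 4) + c * 2) := Real.exp_le_exp.mpr h2
    _ = Real.exp (4 * k + 2 * c) * Real.log y ^ k := by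
        rw [show (k : ℝ) * (Real.log (Real.log y) + 4) + c * 2 =
          (4 * k + 2 * c) + (k : ℝ) * Real.log (Real.log y) by ring, Real.exp_add,
          Real.exp_nat_mul, Real.exp_log hlogy]

/-! ## `𝒩(𝔮)` is the set of `D⁴`-smooth numbers -/

/-- A prime divides `𝔮 = ∏_{q<D⁴} q` iff it is `< D⁴`. [cite: Zhang2022LandauSiegel, §15 p.86 (`𝔮`)] -/
theorem prime_dvd_frakq_iff {D q : ℕ} (hq : q.Prime) : q ∣ frakq D ↔ q < D ^ 4 := by
  rw [frakq, Prime.dvd_finsetProd_iff hq.prime]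
  constructor
  · rintro ⟨p, hp, hqp⟩
    rw [Finset.mem_filter, Finset.mem_range] at hp
    have : q = p := (Nat.prime_dvd_prime_iff_eq hq hp.2).mp hqp
    rw [this]; exact hp.1
  · intro h
    exact ⟨q, Finset.mem_filter.mpr ⟨Finset.mem_range.mpr h, hq⟩, dvd_rfl⟩

/-- **`𝒩(𝔮) = {D⁴-smooth numbers}`**: `n ∈ Skeleton.nset (Skeleton.frakq D)` iff `n ≠ 0` and every
prime factor of `n` is `< D⁴`. [cite: Zhang2022LandauSiegel, §15 p.86; §16 p.93] -/
theorem mem_nset_frakq_iff {D n : ℕ} : n ∈ nset (frakq D) ↔ n ∈ Nat.smoothNumbers (D ^ 4) := by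
  rw [Nat.mem_smoothNumbers]
  constructor
  · rintro ⟨hpos, hdiv⟩
    refine ⟨hpos.ne', fun q hq => ?_⟩
    have hq' := (Nat.mem_primeFactorsList hpos.ne').mp hq
    exact (prime_dvd_frakq_iff hq'.1).mp (hdiv q hq'.1 hq'.2)
  · rintro ⟨h0, hlt⟩
    refine ⟨Nat.pos_of_ne_zero h0, fun q hq hqn => ?_⟩
    exact (prime_dvd_frakq_iff hq).mpr (hlt q ((Nat.mem_primeFactorsList h0).mpr ⟨hq, hqn⟩))

/-- **The §16/§15 summation device, assembled**: if a weight `w` on the `D⁴`-smooth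
numbers is dominated by a multiplicative majorant, `w(n) ≤ M_a(n)` with `a(q,1) ≤ k + c₁/q` — more
generally with Euler factors `Σ_{r≥1} a(q,r)/q^r ≤ k/q + c/q²` — then for `D⁴ ≥ 3`
`Σ_{n∈A} w(n)/n ≤ e^{4k+2c}(log D⁴)^k` for every finite `A ⊆ 𝒩(𝔮)`.
[cite: Zhang2022LandauSiegel, §16 (16.15) p.94] -/
theorem sum_nset_frakq_div_le_log_pow {D : ℕ} (hD : 3 ≤ D ^ 4) {a : ℕ → ℕ → ℝ} (ha : ∀ q r, 0 ≤ a q r)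
    (hsum : ∀ q : ℕ, q.Prime → Summable fun r : ℕ => a q (r + 1) / (q : ℝ) ^ (r + 1))
    (k : ℕ) {c : ℝ} (hc : 0 ≤ c)
    (hloc : ∀ q ∈ (D ^ 4).primesBelow,
      ∑' r : ℕ, a q (r + 1) / (q : ℝ) ^ (r + 1) ≤ (k : ℝ) / q + c / (q : ℝ) ^ 2)
    {w : ℕ → ℝ} {A : Finset ℕ} (hA : ∀ n ∈ A, n ∈ nset (frakq D))
    (hw : ∀ n ∈ A, w n ≤ ∏ q ∈ n.primeFactors, a q (n.factorization q)) :
    ∑ n ∈ A, w n / n ≤ Real.exp (4 * k + 2 * c) * Real.log ((D ^ 4 : ℕ) : ℝ) ^ k := by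
  have hA' : ∀ n ∈ A, n ∈ Nat.smoothNumbers (D ^ 4) := fun n hn => mem_nset_frakq_iff.mp (hA n hn)
  calc ∑ n ∈ A, w n / n ≤ ∑ n ∈ A, (∏ q ∈ n.primeFactors, a q (n.factorization q)) / n :=
        Finset.sum_le_sum fun n hn => div_le_div_of_nonneg_right (hw n hn) (Nat.cast_nonneg n)
    _ ≤ ∏ q ∈ (D ^ 4).primesBelow, (1 + ∑' r : ℕ, a q (r + 1) / (q : ℝ) ^ (r + 1)) :=
        sum_smooth_multMajorant_div_le_prod ha hsum hA'
    _ ≤ Real.exp (4 * k + 2 * c) * Real.log ((D ^ 4 : ℕ) : ℝ) ^ k :=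
        prod_primesBelow_one_add_le_log_pow hD k hc
          (fun q hq => tsum_nonneg fun r => div_nonneg (ha _ _) (pow_nonneg (Nat.cast_nonneg q) _))
          hloc

end Literature.NumberTheory.LFunctions.Zhang2022.SmoothEulerMajorant

end
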